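import Summits.HodgeConjecture.CorCM.GaloisMetacyclicTwoPowerSheet
import Summits.HodgeConjecture.CorCM.CyclotomicTwoPowerPCyclicNormObstruction
import HarnessLib

/-!
# Galois CM fields with group `C_p ⋊_r C_{2^{a+j+1}}` (`r^{2^j} ≡ 1 (mod p)`), `2^{a+1} ∥ p^f − 1`, `j ≤ a + 1`: every
# primitive CM type is nondegenerate — the Hodge conjecture for all powers of their simple CM abelian `2^{a+j}p`-folds

COR-CM (cell `pub-hodgecm2`), binder seat b04 (gen 27), count-neutral — the `2^j`-SHEET PROGRAMME (A7-JUNCTION gen-26 addendum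
§C, road map (vi)): the theorem on CM fields and the unconditional capstone for the family with an action of order dividing
`2^j`, ANY `j ≥ 1` (part (i) `CorCM/CyclicSheetAnnihilator`, (ii) `CorCM/CyclicSheetMatrix` + `CorCM/SemilinearKernelNormCyclic`,
(iv) `CorCM/CyclotomicTwoPowerPCyclic{NormDescent,NormObstruction}`, (v) `CorCM/GaloisMetacyclicTwoPowerSheet`).  It subsumes
gens 25/26 (`j = 1`: `C_p ⋊ C_{2^{a+2}}`, inversion) and gen 26 (`j = 2`: `C_p ⋊₄ C_{2^{a+3}}`).  KERNEL ONLY: theorems; no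
definition, no named fact, no `sorry`.  `HC_CM` is neither used nor claimed: this is the Hodge conjecture for a NAMED CLASS of
CM abelian varieties, proved outright.

SETTING.  `K` a Galois CM field with `Gal(K/ℚ) ≅ C_p ⋊_r C_{2^{a+j+1}} = ⟨u, y | u^p = y^{2^{a+j+1}} = 1, y u y⁻¹ = u^r⟩`,
`r^{2^j} ≡ 1 (mod p)` (Mathlib model `Multiplicative (ZMod p) ⋊[φ] Multiplicative (ZMod (2^(a+j+1)))`, `φ(1) v = v^r`);
`[K:ℚ] = 2^{a+j+1} p`; complex conjugation is the unique involution `y^{2^{a+j}}`.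

THEOREM (`isNondegenerate_of_isPrimitive_of_pow_sub_one`).  If `1 ≤ j ≤ a + 1` and `2^{a+1} ∣ p^f − 1`, `2^{a+2} ∤ p^f − 1` for
some `f` (equivalently `2^{a+2} ∤ p − 1` and `2^{a+1} ∤ p + 1`, `isNondegenerate_of_isPrimitive_of_not_dvd`), then EVERY
PRIMITIVE CM type of `K` is NONDEGENERATE (rank `2^{a+j}p + 1`); hence every SIMPLE abelian variety (dimension `2^{a+j}p`) with
complex multiplication by `K` satisfies the HODGE CONJECTURE together with ALL ITS POWERS
(`hodgeConjectureFor_pow_of_isSimple_of_pow_sub_one`).  In words, with `m = a + j + 1`: **`C_p ⋊_r C_{2^m}` (action of order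
dividing `2^j`) is GOOD whenever `m ≥ 2j` and `v₂(p^f − 1) = m − j` for some `f`** — e.g. `C₃ ⋊ C₁₆` (`j = 1`), `C₅ ⋊₄ C₁₆`
(`j = 2`), `C₁₇ ⋊₈ C₁₂₈` (`j = 3`, order `2176`); whereas `C₅ ⋊₄ C₈` (`m = 3 < 2j`) is BAD (`CorCM/GaloisFortyC5Semidirect4C8Degenerate`).

* §1 `pow_two_pow_add_mod_eq_one`, `pow_pow_mod_eq_one`, `ne_two_of_two_pow_dvd_pow_sub_one`, `map_complexConj_eq_metacyclic`,
  `finrank_eq_metacyclic`.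
* §2 `isNondegenerate_of_isPrimitive_metacyclic` (conditional on `hN`).
* §3 **`isNondegenerate_of_isPrimitive_of_pow_sub_one`**, `isNondegenerate_of_isPrimitive_of_not_dvd`,
  `cmTypeRank_eq_of_isPrimitive_of_pow_sub_one`, **`hodgeConjectureFor_pow_of_isSimple_of_pow_sub_one`**,
  `hodgeConjectureFor_pow_of_isSimple_of_not_dvd`, `hodgeConjectureFor_of_isSimple_of_pow_sub_one`,
  `hodgeClassSpan_pow_eq_divisorClassesSpan_of_isSimple_of_pow_sub_one`, `dim_eq_of_metacyclic`.
* §4 instances: `C₃ ⋊ C₁₆` (order `48`, `j = 1`), `C₅ ⋊₄ C₁₆` (order `80`, `j = 2`), `C₁₇ ⋊₈ C₁₂₈` (order `2176`, `j = 3`),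
  `C₄₁ ⋊₈ C₆₄` (order `2624`, `j = 3`).

## References

* [Kubota1965] T. Kubota, Trans. AMS 118 (1965), §2, §4 Lemma 2.
* [Dodson1984] B. Dodson, *The structure of Galois groups of CM-fields*, Trans. AMS 283 (1984), §3.1, §5.3.
* [Shimura1998] G. Shimura, *Abelian Varieties with Complex Multiplication and Modular Functions*, §8.2 Prop. 26.
* [Gordon1999HodgeAVSurvey] B. B. Gordon, *A survey of the Hodge conjecture for abelian varieties*, Thm. 6.4, §9.4.
* [Pierce1982] R. S. Pierce, *Associative Algebras*, GTM 88, Springer 1982, §15.1 (cyclic algebras, the norm criterion).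
-/

noncomputable section

open CategoryTheory CategoryTheory.Limits NumberField
open scoped BigOperators

namespace Summit.HodgeConjecture.CorCM.GaloisMetacyclicTwoPower

open Literature.NumberTheory.ComplexMultiplication
open Literature.AlgebraicGeometry.Motives (AbelianVariety CMType)
open Literature.AlgebraicGeometry.HodgeTheory
open Literature.AlgebraicGeometry.ComplexMultiplication (IsCMTypeRealisation isSimple_iff_isPrimitive)
open Literature.AlgebraicGeometry.Pohlmann1968
open Summit.HodgeConjecture.CorCM.GaloisRank
open Summit.HodgeConjecture.CorCM.CyclotomicTwoPowerP.Cyclic (exists_subfield_rho_pow)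
open Summit.HodgeConjecture.CorCM.CyclotomicTwoPowerP.Residue (exists_pow_sub_one_of_not_dvd)

/-! ## §1 Arithmetic of the hypotheses; complex conjugation -/

section Arith

variable {p a : ℕ}

/-- `r^{2^j} ≡ 1 (mod p)` ⟹ `r^{2^{k+j}} ≡ 1 (mod p)`. [folklore] -/
theorem pow_two_pow_add_mod_eq_one (hp : p.Prime) (r : ℕ) {j : ℕ} (hr : r ^ 2 ^ j % p = 1) (k : ℕ) :
    r ^ 2 ^ (k + j) % p = 1 := by
  rw [pow_add, mul_comm, pow_mul, Nat.pow_mod, hr, one_pow, Nat.mod_eq_of_lt hp.one_lt]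

/-- `r^{2^j} ≡ 1 (mod p)` ⟹ `(r^m)^{2^j} ≡ 1 (mod p)`. [folklore] -/
theorem pow_pow_mod_eq_one (hp : p.Prime) (r : ℕ) {j : ℕ} (hr : r ^ 2 ^ j % p = 1) (m : ℕ) :
    (r ^ m) ^ 2 ^ j % p = 1 := by
  rw [← pow_mul, mul_comm, pow_mul, Nat.pow_mod, hr, one_pow, Nat.mod_eq_of_lt hp.one_lt]

/-- `2^{a+1} ∣ p^f − 1`, `2^{a+2} ∤ p^f − 1` ⟹ `p ≠ 2`. [folklore] -/
theorem ne_two_of_two_pow_dvd_pow_sub_one {f : ℕ} (hf1 : 2 ^ (a + 1) ∣ p ^ f - 1) (hf2 : ¬ 2 ^ (a + 2) ∣ p ^ f - 1) :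
    p ≠ 2 := by
  rintro rfl
  have h2 : (2 : ℕ) ∣ 2 ^ (a + 1) := dvd_pow_self 2 (Nat.succ_ne_zero a)
  have h3 : 2 ∣ 2 ^ f - 1 := h2.trans hf1
  rcases Nat.eq_zero_or_pos f with hf | hf
  · subst hf; simp at hf2
  · have h5 : 2 ∣ 2 ^ f := dvd_pow_self 2 hf.ne'
    have h6 : 1 ≤ 2 ^ f := Nat.one_le_two_pow
    have h7 : 2 ∣ 2 ^ f - (2 ^ f - 1) := Nat.dvd_sub h5 h3
    rw [Nat.sub_sub_self h6] at h7
    exact absurd h7 (by norm_num)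

variable [Fact p.Prime] {j : ℕ}
variable (φ : Multiplicative (ZMod (2 ^ (a + j + 1))) →* MulAut (Multiplicative (ZMod p))) (r : ℕ)
  (hφ : ∀ v : Multiplicative (ZMod p), φ (Multiplicative.ofAdd 1) v = v ^ r) (hr : r ^ 2 ^ j % p = 1)
variable {K : Type} [Field K] [NumberField K] [IsCMField K]

include hφ hr in
/-- Complex conjugation maps to `y^{2^{a+j}} = inr 2^{a+j}` under any isomorphism `Gal(K/ℚ) ≃ C_p ⋊_r C_{2^{a+j+1}}`.
[cite: Dodson1984, §5.3] -/
theorem map_complexConj_eq_metacyclic (hp2 : p ≠ 2)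
    (e : (K ≃ₐ[ℚ] K) ≃* Multiplicative (ZMod p) ⋊[φ] Multiplicative (ZMod (2 ^ (a + j + 1)))) :
    e ((IsCMField.complexConj K).restrictScalars ℚ) =
      SemidirectProduct.inr (Multiplicative.ofAdd ((2 ^ (a + j) : ℕ) : ZMod (2 ^ (a + j + 1)))) :=
  GaloisOddMetacyclic.map_complexConj_eq (k := a + j) r φ hφ Fact.out hp2
    (pow_two_pow_add_mod_eq_one Fact.out r hr a) e

omit [IsCMField K] in
/-- `[K:ℚ] = 2^{a+j+1} p`. [folklore] -/
theorem finrank_eq_metacyclic [IsGalois ℚ K]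
    (e : (K ≃ₐ[ℚ] K) ≃* Multiplicative (ZMod p) ⋊[φ] Multiplicative (ZMod (2 ^ (a + j + 1)))) :
    Module.finrank ℚ K = 2 ^ (a + j + 1) * p :=
  GaloisOddMetacyclic.finrank_eq (k := a + j) φ Fact.out e

end Arith

/-! ## §2 Nondegeneracy, conditional form -/

section Field

variable {p a : ℕ} [Fact p.Prime]
variable {K : Type} [Field K] [NumberField K] [IsCMField K] [IsGalois ℚ K]

/-- **THEOREM (conditional form).  `Gal(K/ℚ) ≅ C_p ⋊_r C_{2^{a+j+1}}` (`p` odd, `φ(1) v = v^r`, `r^{2^j} ≡ 1`, `j ≥ 1`) and no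
`ω^{2^{j−1}(2t+1)}` (`ω^{2^a} = −1`) is a degree-`2^j` norm `∏_{i<2^j} σ^i(w)` for a subfield `M ⊇ μ_{2^{a+1}p}` of `ℂ` and a ring
endomorphism `σ` (`σ^{2^j} = 1`) fixing `μ_{2^{a+1}}` and undoing the `r`-th power on `μ_p`: every PRIMITIVE CM type of `K` is
NONDEGENERATE.** [cite: Kubota1965, §4 Lemma 2] [cite: Shimura1998, §8.2 Prop. 26] [cite: Pierce1982, §15.1] -/
theorem isNondegenerate_of_isPrimitive_metacyclic (hp2 : p ≠ 2) {j : ℕ} (hj1 : 1 ≤ j)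
    (φ : Multiplicative (ZMod (2 ^ (a + j + 1))) →* MulAut (Multiplicative (ZMod p))) (r : ℕ)
    (hφ : ∀ v : Multiplicative (ZMod p), φ (Multiplicative.ofAdd 1) v = v ^ r) (hr : r ^ 2 ^ j % p = 1)
    (M : Subfield ℂ) (σ : M →+* M) (hM : ∀ z : ℂ, z ^ (2 ^ (a + 1) * p) = 1 → z ∈ M)
    (hσ2 : ∀ z : M, (z : ℂ) ^ 2 ^ (a + 1) = 1 → σ z = z) (hσp : ∀ z : M, (z : ℂ) ^ p = 1 → σ (z ^ r) = z)
    (hσn : ∀ z : M, σ^[2 ^ j] z = z)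
    (hN : ∀ (w : M) (ω : ℂ), ω ^ 2 ^ a = -1 → ∀ t : ℕ,
      ((∏ i ∈ Finset.range (2 ^ j), σ^[i] w : M) : ℂ) ≠ ω ^ (2 ^ (j - 1) * (2 * t + 1)))
    (e : (K ≃ₐ[ℚ] K) ≃* Multiplicative (ZMod p) ⋊[φ] Multiplicative (ZMod (2 ^ (a + j + 1)))) {Φ : CMType K}
    (φ₀ : K →+* ℂ) (hprim : IsPrimitive (ℂ ≃+* ℂ) Φ.1 φ₀) : IsNondegenerate Φ := by
  classical
  have hp : p.Prime := Fact.out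
  haveI : NeZero p := ⟨hp.ne_zero⟩
  haveI : Fintype (Multiplicative (ZMod p) ⋊[φ] Multiplicative (ZMod (2 ^ (a + j + 1)))) :=
    Fintype.ofEquiv _ SemidirectProduct.equivProd.symm
  have hc := map_complexConj_eq_metacyclic φ r hφ hr hp2 e
  set S : Finset (Multiplicative (ZMod p) ⋊[φ] Multiplicative (ZMod (2 ^ (a + j + 1)))) :=
    Finset.univ.filter fun y => embOf φ₀ (e.symm y) ∈ Φ.1 with hS_def
  have hS : ∀ y, y ∈ S ↔ embOf φ₀ (e.symm y) ∈ Φ.1 := fun y => by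
    simp only [hS_def, Finset.mem_filter, Finset.mem_univ, true_and]
  have hScm := model_mul_mem_iff e hc Φ φ₀ S hS
  have hv1 : (SemidirectProduct.inl (Multiplicative.ofAdd (((2 ^ (a + 1) : ℕ) : ZMod p))) :
      Multiplicative (ZMod p) ⋊[φ] Multiplicative (ZMod (2 ^ (a + j + 1)))) ≠ 1 := by
    intro h
    rw [← map_one (SemidirectProduct.inl : Multiplicative (ZMod p) →* _), SemidirectProduct.inl_inj] at h
    have h4 : (((2 ^ (a + 1) : ℕ) : ZMod p)) = 0 := by
      have := congrArg Multiplicative.toAdd h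
      simpa using this
    rw [ZMod.natCast_eq_zero_iff] at h4
    exact hp2 ((Nat.prime_dvd_prime_iff_eq hp Nat.prime_two).1 (hp.dvd_of_dvd_pow h4))
  have hstab : ¬ ∀ w : Multiplicative (ZMod p) ⋊[φ] Multiplicative (ZMod (2 ^ (a + j + 1))),
      w ∈ S ↔ SemidirectProduct.inl (Multiplicative.ofAdd (((2 ^ (a + 1) : ℕ) : ZMod p))) * w ∈ S :=
    fun h => not_isPrimitive_of_leftStabiliser e Φ φ₀ S hS hv1 h hprim
  exact (isNondegenerate_iff_forall_annihilator e hc Φ φ₀ S hS).2 fun b hb hann =>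
    eq_zero_of_annihilated_metacyclic hp2 hj1 φ r hφ hr M σ hM hσ2 hσp hσn hN S hScm hstab b hb hann

end Field

/-! ## §3 Nondegeneracy and the Hodge conjecture for `2^{a+1} ∥ p^f − 1`, `j ≤ a + 1` — unconditionally -/

section Unconditional

variable {p a : ℕ} [Fact p.Prime]
variable {K : Type} [Field K] [NumberField K] [IsCMField K] [IsGalois ℚ K]
variable {Φ : CMType K} {A : AbelianVariety ℂ} {ι : 𝓞 K →+* End A}
  {θ : K →+* Module.End ℂ (complexBetti A.X 1)}

/-- **THEOREM.  `Gal(K/ℚ) ≅ C_p ⋊_r C_{2^{a+j+1}}` (`φ(1) v = v^r`, `r^{2^j} ≡ 1 (mod p)`, `1 ≤ j ≤ a + 1`) with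
`2^{a+1} ∣ p^f − 1`, `2^{a+2} ∤ p^f − 1` for some `f`: every PRIMITIVE CM type of `K` is NONDEGENERATE** — unconditionally.
[cite: Kubota1965, §4 Lemma 2] [cite: Shimura1998, §8.2 Prop. 26] [cite: Pierce1982, §15.1] -/
theorem isNondegenerate_of_isPrimitive_of_pow_sub_one {j : ℕ} (hj1 : 1 ≤ j) (hja : j ≤ a + 1) {f : ℕ}
    (hf1 : 2 ^ (a + 1) ∣ p ^ f - 1) (hf2 : ¬ 2 ^ (a + 2) ∣ p ^ f - 1)
    (φ : Multiplicative (ZMod (2 ^ (a + j + 1))) →* MulAut (Multiplicative (ZMod p))) (r : ℕ)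
    (hφ : ∀ v : Multiplicative (ZMod p), φ (Multiplicative.ofAdd 1) v = v ^ r) (hr : r ^ 2 ^ j % p = 1)
    (e : (K ≃ₐ[ℚ] K) ≃* Multiplicative (ZMod p) ⋊[φ] Multiplicative (ZMod (2 ^ (a + j + 1)))) {Φ : CMType K}
    (φ₀ : K →+* ℂ) (hprim : IsPrimitive (ℂ ≃+* ℂ) Φ.1 φ₀) : IsNondegenerate Φ := by
  have hp : p.Prime := Fact.out
  have hp2 := ne_two_of_two_pow_dvd_pow_sub_one hf1 hf2
  -- `σ : ζ_p ↦ ζ_p^{r'}`, `r' = r^{2^{a+j+1} − 1}` (so that `σ(z^r) = z` on `μ_p`)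
  obtain ⟨M, σ, hM, hσ2, hσp', hσn, hN⟩ := exists_subfield_rho_pow (a := a) hp hj1 hja hf1 hf2 (r ^ (2 ^ (a + j + 1) - 1))
    (pow_pow_mod_eq_one hp r hr _)
  have hrr : r * r ^ (2 ^ (a + j + 1) - 1) % p = 1 := by
    rw [← pow_succ', Nat.sub_add_cancel Nat.one_le_two_pow, show a + j + 1 = (a + 1) + j by ring]
    exact pow_two_pow_add_mod_eq_one hp r hr (a + 1)
  have hσp : ∀ z : M, (z : ℂ) ^ p = 1 → σ (z ^ r) = z := fun z hz => by
    have hzr : ((z ^ r : M) : ℂ) ^ p = 1 := by rw [SubmonoidClass.coe_pow, ← pow_mul, mul_comm, pow_mul, hz, one_pow]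
    rw [hσp' _ hzr, ← pow_mul]
    apply Subtype.ext
    rw [SubmonoidClass.coe_pow, ← Nat.div_add_mod (r * r ^ (2 ^ (a + j + 1) - 1)) p, hrr, pow_add, pow_mul, hz, one_pow,
      one_mul, pow_one]
  exact isNondegenerate_of_isPrimitive_metacyclic hp2 hj1 φ r hφ hr M σ hM hσ2 hσp hσn hN e φ₀ hprim

/-- **The same under `2^{a+2} ∤ p − 1`, `2^{a+1} ∤ p + 1`** (`p` odd; lifting the exponent supplies `f`).
[cite: Kubota1965, §4 Lemma 2] [cite: Shimura1998, §8.2 Prop. 26] -/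
theorem isNondegenerate_of_isPrimitive_of_not_dvd (hp2 : p ≠ 2) {j : ℕ} (hj1 : 1 ≤ j) (hja : j ≤ a + 1)
    (h1 : ¬ 2 ^ (a + 2) ∣ p - 1) (h2 : ¬ 2 ^ (a + 1) ∣ p + 1)
    (φ : Multiplicative (ZMod (2 ^ (a + j + 1))) →* MulAut (Multiplicative (ZMod p))) (r : ℕ)
    (hφ : ∀ v : Multiplicative (ZMod p), φ (Multiplicative.ofAdd 1) v = v ^ r) (hr : r ^ 2 ^ j % p = 1)
    (e : (K ≃ₐ[ℚ] K) ≃* Multiplicative (ZMod p) ⋊[φ] Multiplicative (ZMod (2 ^ (a + j + 1)))) {Φ : CMType K}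
    (φ₀ : K →+* ℂ) (hprim : IsPrimitive (ℂ ≃+* ℂ) Φ.1 φ₀) : IsNondegenerate Φ := by
  obtain ⟨f, hf1, hf2⟩ := exists_pow_sub_one_of_not_dvd (a := a) (Fact.out : p.Prime) hp2 h1 h2
  exact isNondegenerate_of_isPrimitive_of_pow_sub_one hj1 hja hf1 hf2 φ r hφ hr e φ₀ hprim

/-- The rank: `cmTypeRank Φ = 2^{a+j} p + 1`. [cite: Kubota1965, §2 (p. 115)] -/
theorem cmTypeRank_eq_of_isPrimitive_of_pow_sub_one {j : ℕ} (hj1 : 1 ≤ j) (hja : j ≤ a + 1) {f : ℕ}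
    (hf1 : 2 ^ (a + 1) ∣ p ^ f - 1) (hf2 : ¬ 2 ^ (a + 2) ∣ p ^ f - 1)
    (φ : Multiplicative (ZMod (2 ^ (a + j + 1))) →* MulAut (Multiplicative (ZMod p))) (r : ℕ)
    (hφ : ∀ v : Multiplicative (ZMod p), φ (Multiplicative.ofAdd 1) v = v ^ r) (hr : r ^ 2 ^ j % p = 1)
    (e : (K ≃ₐ[ℚ] K) ≃* Multiplicative (ZMod p) ⋊[φ] Multiplicative (ZMod (2 ^ (a + j + 1)))) {Φ : CMType K}
    (φ₀ : K →+* ℂ) (hprim : IsPrimitive (ℂ ≃+* ℂ) Φ.1 φ₀) : cmTypeRank Φ = 2 ^ (a + j) * p + 1 := by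
  have h := isNondegenerate_of_isPrimitive_of_pow_sub_one hj1 hja hf1 hf2 φ r hφ hr e φ₀ hprim
  rw [isNondegenerate_iff, finrank_eq_metacyclic φ e] at h
  rw [h, pow_succ 2 (a + j)]
  have : 0 < 2 ^ (a + j) * p := by have := (Fact.out : p.Prime).pos; positivity
  rw [show 2 ^ (a + j) * 2 * p = 2 ^ (a + j) * p * 2 by ring]
  omega

/-- **THE HODGE CONJECTURE FOR EVERY POWER OF EVERY SIMPLE ABELIAN VARIETY WITH COMPLEX MULTIPLICATION BY A GALOIS CM
FIELD WITH GROUP `C_p ⋊_r C_{2^{a+j+1}}` (`r^{2^j} ≡ 1`, `1 ≤ j ≤ a + 1`), `2^{a+1} ∥ p^f − 1`** (dimension `2^{a+j} p`) —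
unconditionally. [cite: Gordon1999HodgeAVSurvey, Thm. 6.4] [cite: Shimura1998, §8.2 Prop. 26] -/
theorem hodgeConjectureFor_pow_of_isSimple_of_pow_sub_one {j : ℕ} (hj1 : 1 ≤ j) (hja : j ≤ a + 1) {f : ℕ}
    (hf1 : 2 ^ (a + 1) ∣ p ^ f - 1) (hf2 : ¬ 2 ^ (a + 2) ∣ p ^ f - 1)
    (φ : Multiplicative (ZMod (2 ^ (a + j + 1))) →* MulAut (Multiplicative (ZMod p))) (r : ℕ)
    (hφ : ∀ v : Multiplicative (ZMod p), φ (Multiplicative.ofAdd 1) v = v ^ r) (hr : r ^ 2 ^ j % p = 1)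
    (e : (K ≃ₐ[ℚ] K) ≃* Multiplicative (ZMod p) ⋊[φ] Multiplicative (ZMod (2 ^ (a + j + 1))))
    (hA : IsCMTypeRealisation Φ A ι θ) (hs : A.IsSimple) (N : ℕ) :
    HodgeConjectureFor (⨁ fun _ : Fin N => A).dim (⨁ fun _ : Fin N => A).X := by
  obtain ⟨φ₀⟩ := (inferInstance : Nonempty (K →+* ℂ))
  exact (isNondegenerate_of_isPrimitive_of_pow_sub_one hj1 hja hf1 hf2 φ r hφ hr e φ₀
    ((isSimple_iff_isPrimitive hA φ₀).1 hs)).hodgeConjectureFor_pow hA N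

/-- The Hodge conjecture for every power, hypotheses on `p ± 1`. [cite: Gordon1999HodgeAVSurvey, Thm. 6.4] -/
theorem hodgeConjectureFor_pow_of_isSimple_of_not_dvd (hp2 : p ≠ 2) {j : ℕ} (hj1 : 1 ≤ j) (hja : j ≤ a + 1)
    (h1 : ¬ 2 ^ (a + 2) ∣ p - 1) (h2 : ¬ 2 ^ (a + 1) ∣ p + 1)
    (φ : Multiplicative (ZMod (2 ^ (a + j + 1))) →* MulAut (Multiplicative (ZMod p))) (r : ℕ)
    (hφ : ∀ v : Multiplicative (ZMod p), φ (Multiplicative.ofAdd 1) v = v ^ r) (hr : r ^ 2 ^ j % p = 1)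
    (e : (K ≃ₐ[ℚ] K) ≃* Multiplicative (ZMod p) ⋊[φ] Multiplicative (ZMod (2 ^ (a + j + 1))))
    (hA : IsCMTypeRealisation Φ A ι θ) (hs : A.IsSimple) (N : ℕ) :
    HodgeConjectureFor (⨁ fun _ : Fin N => A).dim (⨁ fun _ : Fin N => A).X := by
  obtain ⟨f, hf1, hf2⟩ := exists_pow_sub_one_of_not_dvd (a := a) (Fact.out : p.Prime) hp2 h1 h2
  exact hodgeConjectureFor_pow_of_isSimple_of_pow_sub_one hj1 hja hf1 hf2 φ r hφ hr e hA hs N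

/-- The Hodge conjecture for the simple abelian variety itself. [cite: Gordon1999HodgeAVSurvey, Thm. 6.4] -/
theorem hodgeConjectureFor_of_isSimple_of_pow_sub_one {j : ℕ} (hj1 : 1 ≤ j) (hja : j ≤ a + 1) {f : ℕ}
    (hf1 : 2 ^ (a + 1) ∣ p ^ f - 1) (hf2 : ¬ 2 ^ (a + 2) ∣ p ^ f - 1)
    (φ : Multiplicative (ZMod (2 ^ (a + j + 1))) →* MulAut (Multiplicative (ZMod p))) (r : ℕ)
    (hφ : ∀ v : Multiplicative (ZMod p), φ (Multiplicative.ofAdd 1) v = v ^ r) (hr : r ^ 2 ^ j % p = 1)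
    (e : (K ≃ₐ[ℚ] K) ≃* Multiplicative (ZMod p) ⋊[φ] Multiplicative (ZMod (2 ^ (a + j + 1))))
    (hA : IsCMTypeRealisation Φ A ι θ) (hs : A.IsSimple) : HodgeConjectureFor A.dim A.X := by
  obtain ⟨φ₀⟩ := (inferInstance : Nonempty (K →+* ℂ))
  exact (isNondegenerate_of_isPrimitive_of_pow_sub_one hj1 hja hf1 hf2 φ r hφ hr e φ₀
    ((isSimple_iff_isPrimitive hA φ₀).1 hs)).hodgeConjectureFor hA

/-- `Bᵐ(Aⁿ) ⊗ ℂ = Dᵐ(Aⁿ) ⊗ ℂ` on every power (White–Hazama). [cite: Gordon1999HodgeAVSurvey, §9.3] -/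
theorem hodgeClassSpan_pow_eq_divisorClassesSpan_of_isSimple_of_pow_sub_one {j : ℕ} (hj1 : 1 ≤ j) (hja : j ≤ a + 1)
    {f : ℕ} (hf1 : 2 ^ (a + 1) ∣ p ^ f - 1) (hf2 : ¬ 2 ^ (a + 2) ∣ p ^ f - 1)
    (φ : Multiplicative (ZMod (2 ^ (a + j + 1))) →* MulAut (Multiplicative (ZMod p))) (r : ℕ)
    (hφ : ∀ v : Multiplicative (ZMod p), φ (Multiplicative.ofAdd 1) v = v ^ r) (hr : r ^ 2 ^ j % p = 1)
    (e : (K ≃ₐ[ℚ] K) ≃* Multiplicative (ZMod p) ⋊[φ] Multiplicative (ZMod (2 ^ (a + j + 1))))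
    (hA : IsCMTypeRealisation Φ A ι θ) (hs : A.IsSimple) (N m : ℕ) :
    Literature.AlgebraicGeometry.VanGeemen1994.hodgeClassSpan (⨁ fun _ : Fin N => A).dim (⨁ fun _ : Fin N => A).X m =
      Literature.Barriers.HodgeConjecture.divisorClassesSpan (⨁ fun _ : Fin N => A).X
        (⨁ fun _ : Fin N => A).dim m := by
  obtain ⟨φ₀⟩ := (inferInstance : Nonempty (K →+* ℂ))
  exact (isNondegenerate_of_isPrimitive_of_pow_sub_one hj1 hja hf1 hf2 φ r hφ hr e φ₀
    ((isSimple_iff_isPrimitive hA φ₀).1 hs)).hodgeClassSpan_pow_eq_divisorClassesSpan hA N m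

omit [IsCMField K] in
/-- … and such a simple abelian variety has dimension `2^{a+j} p`. [cite: Shimura1998, §8.2 Prop. 26] -/
theorem dim_eq_of_metacyclic {j : ℕ} (φ : Multiplicative (ZMod (2 ^ (a + j + 1))) →* MulAut (Multiplicative (ZMod p)))
    (e : (K ≃ₐ[ℚ] K) ≃* Multiplicative (ZMod p) ⋊[φ] Multiplicative (ZMod (2 ^ (a + j + 1))))
    (hA : IsCMTypeRealisation Φ A ι θ) : A.dim = 2 ^ (a + j) * p := by
  have h : A.dim = Module.finrank ℚ K / 2 := Literature.AlgebraicGeometry.Motives.schemeDim_eq_holds hA.1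
  rw [finrank_eq_metacyclic φ e, pow_succ 2 (a + j)] at h
  rw [h, show 2 ^ (a + j) * 2 * p = 2 ^ (a + j) * p * 2 by ring, Nat.mul_div_cancel _ (by norm_num)]

end Unconditional

/-! ## §4 Instances: `C₃ ⋊ C₁₆` (`j = 1`), `C₅ ⋊₄ C₁₆` (`j = 2`), `C₁₇ ⋊₈ C₁₂₈` and `C₄₁ ⋊₈ C₆₄` (`j = 3`) -/

section Instances

variable {K : Type} [Field K] [NumberField K] [IsCMField K] [IsGalois ℚ K]
variable {Φ : CMType K} {A : AbelianVariety ℂ} {ι : 𝓞 K →+* End A}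
  {θ : K →+* Module.End ℂ (complexBetti A.X 1)}

/-- **`C₃ ⋊ C₁₆` (order `48`, `j = 1`, `a = 2`, `f = 2`: `8 ∥ 3² − 1`) is GOOD**: every primitive CM type is nondegenerate of
rank `25`, and the Hodge conjecture holds for every power of every simple CM abelian `24`-fold with complex multiplication by a
Galois CM field with this group (the `j = 1` residue case of gen 26, re-derived). [cite: Kubota1965, §4 Lemma 2]
[cite: Gordon1999HodgeAVSurvey, Thm. 6.4] -/
theorem hodgeConjectureFor_pow_of_isSimple_cyclic3_semidirect_16
    (φ : Multiplicative (ZMod (2 ^ (2 + 1 + 1))) →* MulAut (Multiplicative (ZMod 3)))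
    (hφ : ∀ v : Multiplicative (ZMod 3), φ (Multiplicative.ofAdd 1) v = v ^ 2)
    (e : (K ≃ₐ[ℚ] K) ≃* Multiplicative (ZMod 3) ⋊[φ] Multiplicative (ZMod (2 ^ (2 + 1 + 1))))
    (hA : IsCMTypeRealisation Φ A ι θ) (hs : A.IsSimple) (N : ℕ) :
    HodgeConjectureFor (⨁ fun _ : Fin N => A).dim (⨁ fun _ : Fin N => A).X ∧ A.dim = 24 :=
  haveI : Fact (Nat.Prime 3) := ⟨Nat.prime_three⟩
  ⟨hodgeConjectureFor_pow_of_isSimple_of_pow_sub_one (a := 2) (j := 1) (f := 2) le_rfl (by norm_num) (by norm_num)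
      (by norm_num) φ 2 hφ (by norm_num) e hA hs N, by rw [dim_eq_of_metacyclic φ e hA]; norm_num⟩

/-- **`C₅ ⋊₄ C₁₆` (order `80`, `j = 2`, `a = 1`, `φ(1) v = v²`) is GOOD**: every primitive CM type of a Galois CM field with this
group is nondegenerate of rank `41` (the `j = 2` theorem of gen 26, re-derived) — whereas `C₅ ⋊₄ C₈` is BAD.
[cite: Kubota1965, §4 Lemma 2] [cite: Gordon1999HodgeAVSurvey, Thm. 6.4] -/
theorem isNondegenerate_of_isPrimitive_cyclic5_semidirect4_16
    (φ : Multiplicative (ZMod (2 ^ (1 + 2 + 1))) →* MulAut (Multiplicative (ZMod 5)))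
    (hφ : ∀ v : Multiplicative (ZMod 5), φ (Multiplicative.ofAdd 1) v = v ^ 2)
    (e : (K ≃ₐ[ℚ] K) ≃* Multiplicative (ZMod 5) ⋊[φ] Multiplicative (ZMod (2 ^ (1 + 2 + 1)))) (Φ : CMType K)
    (φ₀ : K →+* ℂ) (hprim : IsPrimitive (ℂ ≃+* ℂ) Φ.1 φ₀) : IsNondegenerate Φ ∧ cmTypeRank Φ = 41 :=
  haveI : Fact (Nat.Prime 5) := ⟨Nat.prime_five⟩
  ⟨isNondegenerate_of_isPrimitive_of_not_dvd (a := 1) (j := 2) (by norm_num) (by norm_num) (by norm_num) (by norm_num)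
      (by norm_num) φ 2 hφ (by norm_num) e φ₀ hprim, by
    have h := cmTypeRank_eq_of_isPrimitive_of_pow_sub_one (a := 1) (j := 2) (f := 1) (by norm_num) (by norm_num)
      (by norm_num) (by norm_num) φ 2 hφ (by norm_num) e φ₀ hprim
    rw [h]; norm_num⟩

/-- `C₅ ⋊₄ C₁₆`: the Hodge conjecture for every power of every simple CM abelian `40`-fold.
[cite: Gordon1999HodgeAVSurvey, Thm. 6.4] -/
theorem hodgeConjectureFor_pow_of_isSimple_cyclic5_semidirect4_16
    (φ : Multiplicative (ZMod (2 ^ (1 + 2 + 1))) →* MulAut (Multiplicative (ZMod 5)))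
    (hφ : ∀ v : Multiplicative (ZMod 5), φ (Multiplicative.ofAdd 1) v = v ^ 2)
    (e : (K ≃ₐ[ℚ] K) ≃* Multiplicative (ZMod 5) ⋊[φ] Multiplicative (ZMod (2 ^ (1 + 2 + 1))))
    (hA : IsCMTypeRealisation Φ A ι θ) (hs : A.IsSimple) (N : ℕ) :
    HodgeConjectureFor (⨁ fun _ : Fin N => A).dim (⨁ fun _ : Fin N => A).X ∧ A.dim = 40 :=
  haveI : Fact (Nat.Prime 5) := ⟨Nat.prime_five⟩
  ⟨hodgeConjectureFor_pow_of_isSimple_of_not_dvd (a := 1) (j := 2) (by norm_num) (by norm_num) (by norm_num) (by norm_num)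
      (by norm_num) φ 2 hφ (by norm_num) e hA hs N, by rw [dim_eq_of_metacyclic φ e hA]; norm_num⟩

/-- **`C₁₇ ⋊₈ C₁₂₈` (order `2176`, `j = 3`, `a = 3`, `φ(1) v = v²`, `2` of order `8` mod `17`) is GOOD** — the first family with
an action of order EIGHT: every primitive CM type of a Galois CM field with this group is nondegenerate of rank `1089`, and the
Hodge conjecture holds for every power of every simple CM abelian `1088`-fold with complex multiplication by it.
[cite: Kubota1965, §4 Lemma 2] [cite: Gordon1999HodgeAVSurvey, Thm. 6.4] -/
theorem hodgeConjectureFor_pow_of_isSimple_cyclic17_semidirect8_128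
    (φ : Multiplicative (ZMod (2 ^ (3 + 3 + 1))) →* MulAut (Multiplicative (ZMod 17)))
    (hφ : ∀ v : Multiplicative (ZMod 17), φ (Multiplicative.ofAdd 1) v = v ^ 2)
    (e : (K ≃ₐ[ℚ] K) ≃* Multiplicative (ZMod 17) ⋊[φ] Multiplicative (ZMod (2 ^ (3 + 3 + 1))))
    (hA : IsCMTypeRealisation Φ A ι θ) (hs : A.IsSimple) (N : ℕ) :
    HodgeConjectureFor (⨁ fun _ : Fin N => A).dim (⨁ fun _ : Fin N => A).X ∧ A.dim = 1088 :=
  haveI : Fact (Nat.Prime 17) := ⟨by norm_num⟩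
  ⟨hodgeConjectureFor_pow_of_isSimple_of_not_dvd (a := 3) (j := 3) (by norm_num) (by norm_num) (by norm_num) (by norm_num)
      (by norm_num) φ 2 hφ (by norm_num) e hA hs N, by rw [dim_eq_of_metacyclic φ e hA]; norm_num⟩

/-- `C₁₇ ⋊₈ C₁₂₈`: every primitive CM type is nondegenerate of rank `1089`. [cite: Kubota1965, §4 Lemma 2] -/
theorem isNondegenerate_of_isPrimitive_cyclic17_semidirect8_128
    (φ : Multiplicative (ZMod (2 ^ (3 + 3 + 1))) →* MulAut (Multiplicative (ZMod 17)))
    (hφ : ∀ v : Multiplicative (ZMod 17), φ (Multiplicative.ofAdd 1) v = v ^ 2)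
    (e : (K ≃ₐ[ℚ] K) ≃* Multiplicative (ZMod 17) ⋊[φ] Multiplicative (ZMod (2 ^ (3 + 3 + 1)))) (Φ : CMType K)
    (φ₀ : K →+* ℂ) (hprim : IsPrimitive (ℂ ≃+* ℂ) Φ.1 φ₀) : IsNondegenerate Φ ∧ cmTypeRank Φ = 1089 :=
  haveI : Fact (Nat.Prime 17) := ⟨by norm_num⟩
  ⟨isNondegenerate_of_isPrimitive_of_not_dvd (a := 3) (j := 3) (by norm_num) (by norm_num) (by norm_num) (by norm_num)
      (by norm_num) φ 2 hφ (by norm_num) e φ₀ hprim, by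
    have h := cmTypeRank_eq_of_isPrimitive_of_pow_sub_one (a := 3) (j := 3) (f := 1) (by norm_num) (by norm_num)
      (by norm_num) (by norm_num) φ 2 hφ (by norm_num) e φ₀ hprim
    rw [h]; norm_num⟩

/-- **`C₄₁ ⋊₈ C₆₄` (order `2624`, `j = 3`, `a = 2`, `φ(1) v = v³`, `3` of order `8` mod `41`) is GOOD**: the Hodge conjecture for
every power of every simple CM abelian `1312`-fold with complex multiplication by a Galois CM field with this group.
[cite: Gordon1999HodgeAVSurvey, Thm. 6.4] -/
theorem hodgeConjectureFor_pow_of_isSimple_cyclic41_semidirect8_64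
    (φ : Multiplicative (ZMod (2 ^ (2 + 3 + 1))) →* MulAut (Multiplicative (ZMod 41)))
    (hφ : ∀ v : Multiplicative (ZMod 41), φ (Multiplicative.ofAdd 1) v = v ^ 3)
    (e : (K ≃ₐ[ℚ] K) ≃* Multiplicative (ZMod 41) ⋊[φ] Multiplicative (ZMod (2 ^ (2 + 3 + 1))))
    (hA : IsCMTypeRealisation Φ A ι θ) (hs : A.IsSimple) (N : ℕ) :
    HodgeConjectureFor (⨁ fun _ : Fin N => A).dim (⨁ fun _ : Fin N => A).X ∧ A.dim = 1312 :=
  haveI : Fact (Nat.Prime 41) := ⟨by norm_num⟩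
  ⟨hodgeConjectureFor_pow_of_isSimple_of_not_dvd (a := 2) (j := 3) (by norm_num) (by norm_num) (by norm_num) (by norm_num)
      (by norm_num) φ 3 hφ (by norm_num) e hA hs N, by rw [dim_eq_of_metacyclic φ e hA]; norm_num⟩

end Instances

end Summit.HodgeConjecture.CorCM.GaloisMetacyclicTwoPower

end
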